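import Mathlib
import Literature.Computability.Complexity.LocalAvoidAlgorithms
import Summits.PneNP.PneNP.Theses.Nc03AvoidResidualCore
import Summits.PneNP.PneNP.Theorems.SignDegCertBridge
import Summits.PneNP.PneNP.Theorems.SignDegParity

/-!
# Sign-degree-2 local maps: the signing target (ROUND-18 item K1'') and its reduction to avoidance

For a `k`-local map all of whose tables have sign-degree `≤ 2`, the canonical integer certificate
(`SignDegCertBridge.certOfIntCert` of the uniform-weight data `certOf k 2`) turns range avoidance into a
SIGNING task (`SignRepCertificate.not_mem_range_of_certificate`): find `y ∈ {0,1}^m` whose `±1` reading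
`Y` makes `bias + Σ_v |load_v| + max_X pairForm(X)` smaller than `τ·m = 2m`. This file types that task as
ONE polynomial-time function (`SignDeg2SigningFP k`, OPEN — the joint cut-norm signing engine of the cell's
line «sfm-bl» run on the `k²` slot-pair matrices together with the loads and the bias) and proves the
reduction to the avoidance leaf `SignDeg2OnlyAvoidLinearFP k` (pnp-ideate-p3 ROUND-17 §2 / SketchN2 K1'').
It also types the proposed ROUND-18 TARGET `SignDeg2AvoidLinearFP k` (every table of sign-degree `≤ 2` OR
affine), the affine-split glue statement `AffineSplit k` (item K3), and proves the `k = 3` read-off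
`nc03AvoidLinearFP_of_signDeg2Avoid : SignDeg2AvoidLinearFP 3 → Nc03AvoidLinearFP` (route
Nc03AvoidResidualCore's leaf, stmt-PneNP-19007) from the finite dichotomy
`SignDegParity.three_bit_signDegLE_two_or_parity` («every 3-bit table is sd ≤ 2 or ±XOR₃»).
FRONTIER (range avoidance for local maps); nothing here bears on P vs NP.
-/

namespace Summit.PneNP.PneNP.Theorems.SignDeg2Signing

open Literature.Computability.Complexity SignRepCertificate SignDegIntCert SignDegCertBridge Finset

variable {k n m : ℕ}

/-- The `±1` reading of an answer string. -/
def pmVec (y : Fin m → Bool) : Fin m → ℤ := fun j => pm (y j)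

/-- Each entry of the `±1` reading is `1` or `−1`. -/
lemma pmVec_cases (y : Fin m → Bool) (j : Fin m) : pmVec y j = 1 ∨ pmVec y j = -1 := by
  unfold pmVec pm; cases y j <;> simp

/-- Reading the bits back off the `±1` vector. -/
lemma decide_pmVec (y : Fin m → Bool) : (fun j => decide (pmVec y j = -1)) = y := by
  funext j; unfold pmVec pm; cases y j <;> simp

/-- `y` is SIGN-CERTIFIED for the certificate `c`: some bound `e` on the pair form over all `±1` vectors
with `bias + Σ_v |load_v| + e < τ·m` (the hypothesis of `not_mem_range_of_certificate`). -/
def SigCertified (I : LocalMap k n m) (c : Cert I) (y : Fin m → Bool) : Prop :=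
  ∃ e : ℤ, (∀ X : Fin n → ℤ, (∀ v, X v = 1 ∨ X v = -1) → pairForm I c (pmVec y) X ≤ e) ∧
    bias I c (pmVec y) + ∑ v, |load I c (pmVec y) v| + e < c.τ * m

/-- A sign-certified string lies outside the range. -/
theorem not_mem_range_of_sigCertified (I : LocalMap k n m) (c : Cert I) (y : Fin m → Bool)
    (h : SigCertified I c y) : y ∉ I.range := by
  obtain ⟨e, hp, hs⟩ := h
  have := not_mem_range_of_certificate I c (pmVec y) (pmVec_cases y) e hp hs
  rwa [decide_pmVec] at this

/-- The canonical degree-≤2 certificate of a local map all of whose tables have sign-degree `≤ 2`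
(uniform weight `uniformW k 2`, margin `τ = 2`). -/
noncomputable def canonCert (I : LocalMap k n m) (h : ∀ j, SignDegLE 2 (I.table j)) : Cert I :=
  certOfIntCert I le_rfl fun j => certOf k 2 (I.table j) (h j)

/-- The canonical certificate has margin `2`. -/
@[simp] lemma canonCert_τ (I : LocalMap k n m) (h : ∀ j, SignDegLE 2 (I.table j)) :
    (canonCert I h).τ = 2 := rfl

/-- PROVED (posed by the cell as an open conjecture; see `[status]` below) — `SignDeg2SigningFP k` (**joint
cut-norm signing for sign-degree-≤2 `k`-local maps at linear stretch is in FP**): an absolute `C` and ONE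
polynomial-time string function whose first `m` output bits are SIGN-CERTIFIED for the canonical certificate
of every `k`-local instance with all tables of sign-degree `≤ 2`, `n ≥ 1` and `m ≥ C·n`. Posed by the cell
pnp-ideate (seat p3, ROUND-17, item K1'' of the proposed ROUND-18 route) as the engine statement generalising
`CandCutNorm.CandCutNormSigningFP` (pure CAND, one pair matrix) to `k²` slot-pair matrices plus loads and
bias; the printed algorithms need `m ≥ C·n·log n` for `k = 3` and `m ≥ n^{(k−1)/2}·polylog` in general
[cite: GuruswamiLyuYuan2025, §1].
[status: proved 2026-08-27 for every `k` — `Sd2BlMachine.signDeg2SigningFP`,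
`Theorems/SignDeg2SigningFPLeaf.lean` (p584576; chain `SignDeg2SigningLegs` → `Sd2Bl*` → `Sd2BlMachine*` →
`Sd2BlSigning*`, cell pnp-ideate prover seats)] -/
@[conjecture] def SignDeg2SigningFP (k : ℕ) : Prop :=
  ∃ C : ℕ, ∃ f : List Bool → List Bool, IsPolyTime f ∧
    ∀ n m (I : LocalMap k n m) (h : ∀ j, SignDegLE 2 (I.table j)), 0 < n → C * n ≤ m →
      SigCertified I (canonCert I h) (readOut m (f I.encode))

/-- PROVED (see `[status]` below) — `SignDeg2OnlyAvoidLinearFP k` (**range avoidance for `k`-local maps with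
all tables of sign-degree `≤ 2`, at linear stretch, is in FP**; ROUND-17 §2 item K1''; for `k = 3` it
contains the cell's live target pure-CAND and, with the affine split K3, all of `NC⁰₃`).
[status: proved 2026-08-27 for every `k` — `Sd2BlMachine.signDeg2OnlyAvoidLinearFP`,
`Theorems/SignDeg2SigningFPLeaf.lean` (p584576), via `signDeg2OnlyAvoid_of_signingFP`] -/
@[conjecture] def SignDeg2OnlyAvoidLinearFP (k : ℕ) : Prop :=
  LocalAvoidLinearFP k (fun _ _ I => ∀ j, SignDegLE 2 (I.table j))

/-- **Reduction** `SignDeg2SigningFP k → SignDeg2OnlyAvoidLinearFP k`: same constant, same function. -/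
theorem signDeg2OnlyAvoid_of_signingFP (k : ℕ) :
    SignDeg2SigningFP k → SignDeg2OnlyAvoidLinearFP k := by
  rintro ⟨C, f, hf, hC⟩
  exact ⟨C, f, hf, fun n m I hI hn hm => not_mem_range_of_sigCertified I _ _ (hC n m I hI hn hm)⟩

/-- PROVED (see `[status]` below) — `SignDeg1AvoidLinearFP k` (**range avoidance for `LTF`-local maps — all
tables of sign-degree `≤ 1` — at linear stretch is in FP**; ROUND-17 rung F-N2a). Its mathematics is
`SignDegCertBridge.greedyAvoid_not_mem_range` (one greedy pass, `m > (n+1)·(uniformW k 1)²`); what remained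
was the polynomial-time typing of that pass.
[status: proved 2026-08-27 for every `k` — `SignDeg1AvoidFP.signDeg1AvoidLinearFP_holds`,
`Theorems/SignDeg1AvoidFPLeaf.lean` (p568121; machine `Theorems/SignDeg1AvoidFP.lean`, p566590)] -/
@[conjecture] def SignDeg1AvoidLinearFP (k : ℕ) : Prop :=
  LocalAvoidLinearFP k (fun _ _ I => ∀ j, SignDegLE 1 (I.table j))

/-- `SignDeg2OnlyAvoidLinearFP k → SignDeg1AvoidLinearFP k` (sign-degree is monotone). -/
theorem signDeg1_of_signDeg2Only (k : ℕ) : SignDeg2OnlyAvoidLinearFP k → SignDeg1AvoidLinearFP k := by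
  rintro ⟨C, f, hf, hC⟩
  exact ⟨C, f, hf, fun n m I hI hn hm => hC n m I (fun j => (hI j).mono one_le_two) hn hm⟩

/-! ### The ROUND-18 target (sign-degree ≤ 2 or affine), the affine split, and the `k = 3` read-off -/

/-- `P` is AFFINE over `𝔽₂` — a parity of the arguments in some `S`, possibly negated — stated in `±1` form:
its sign table is `χ_S` or `−χ_S`. -/
def IsAffinePred (P : (Fin k → Bool) → Bool) : Prop :=
  ∃ S : Finset (Fin k), (∀ u, bsgn (P u) = chiQ S u) ∨ (∀ u, bsgn (P u) = -chiQ S u)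

/-- Every 3-bit table has sign-degree `≤ 2` or is affine (`SignDegParity.three_bit_signDegLE_two_or_parity`:
the only exceptions to sign-degree `≤ 2` are `±XOR₃`, which are affine with `S = univ`). -/
theorem signDegLE_two_or_isAffinePred (P : (Fin 3 → Bool) → Bool) : SignDegLE 2 P ∨ IsAffinePred P := by
  rcases SignDegParity.three_bit_signDegLE_two_or_parity P with h | h | h
  · exact Or.inl h
  · exact Or.inr ⟨univ, Or.inl h⟩
  · exact Or.inr ⟨univ, Or.inr h⟩

/-- PROVED (see `[status]` below) — `SignDeg2AvoidLinearFP k` (**range avoidance, at linear stretch, for the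
`k`-local maps each of whose tables has sign-degree `≤ 2` OR is affine, is in FP**; the proposed ROUND-18
TARGET of the cell pnp-ideate, ROUND-17 §2).  At `k = 3` the side condition is vacuous
(`signDegLE_two_or_isAffinePred`), so the `k = 3` case is `NC⁰₃-AVOID` at linear stretch
(`nc03AvoidLinearFP_of_signDeg2Avoid`), open in print [cite: GuruswamiLyuYuan2025, §1]; for `k ≥ 4` it is a
proper sub-class of `NC⁰ₖ` (e.g. `P⋆ = x₀⊕x₁⊕x₂x₃` has sign-degree 3).  Proof: `SignDeg2OnlyAvoidLinearFP k`
(item K1'') + `AffineSplit k` (item K3).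
[status: proved 2026-08-27 for every `k` — `Sd2BlMachine.signDeg2AvoidLinearFP`,
`Theorems/SignDeg2SigningFPLeaf.lean` (p584576), by `signDeg2Avoid_of_items` from the two proved items] -/
@[conjecture] def SignDeg2AvoidLinearFP (k : ℕ) : Prop :=
  LocalAvoidLinearFP k (fun _ _ I => ∀ j, SignDegLE 2 (I.table j) ∨ IsAffinePred (I.table j))

/-- PROVED (see `[status]` below; support-grade) — `AffineSplit k`, the AFFINE-SPLIT glue (ROUND-17 §2 item
K3): an FP solver for all-sign-degree-≤2 instances yields one for sign-degree-≤2-OR-affine instances.  Proof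
(the pattern of `CandStarReduction`, stmt-PneNP-19963): with `≥ n+1` affine outputs, Gaussian elimination
over `𝔽₂` prints a point outside the range of the affine part; otherwise the `≥ m − n ≥ (C−1)·n` non-affine
outputs form an all-sd-≤2 sub-instance on the same inputs, solved by the hypothesis and re-embedded.
[status: proved 2026-08-27 for every `k` — `AffineSplitFP.affineSplit`,
`Theorems/SignDeg2AvoidAffineSplitFP.lean` (p572746; machine and correctness
`Theorems/SignDeg2AvoidAffineSplit{Machine,Correct}.lean`, p571156/p571992)] -/
@[conjecture] def AffineSplit (k : ℕ) : Prop := SignDeg2OnlyAvoidLinearFP k → SignDeg2AvoidLinearFP k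

/-- Assembly of the ROUND-18 target from its two items. -/
theorem signDeg2Avoid_of_items (k : ℕ) :
    SignDeg2OnlyAvoidLinearFP k → AffineSplit k → SignDeg2AvoidLinearFP k := fun h₁ h₃ => h₃ h₁

/-- **`k = 3` read-off**: the sign-degree-≤2-or-affine rung at `k = 3` IS `NC⁰₃-AVOID` at linear stretch —
route Nc03AvoidResidualCore's leaf `Nc03AvoidLinearFP` (stmt-PneNP-19007) — by the finite dichotomy. -/
theorem nc03AvoidLinearFP_of_signDeg2Avoid :
    SignDeg2AvoidLinearFP 3 → Summit.PneNP.PneNP.Theses.Nc03AvoidResidualCore.Nc03AvoidLinearFP :=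
  fun h => LocalAvoidLinearFP.anti (fun _ _ I _ j => signDegLE_two_or_isAffinePred (I.table j)) h

end Summit.PneNP.PneNP.Theorems.SignDeg2Signing
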